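import Summits.RiemannHypothesis.RiemannHypothesis.Theorems.SemilocalNegCertUptoHundredThirtyNineKinkedB
import Summits.RiemannHypothesis.RiemannHypothesis.Theorems.SemilocalNegCertUptoHundredThirtyNineKinkedC
import Summits.RiemannHypothesis.RiemannHypothesis.Theorems.SemilocalNegCertUptoHundredThirtyNineKinkedD
import Summits.RiemannHypothesis.RiemannHypothesis.Theorems.SemilocalNegCertUptoHundredThirtyNineKinkedE
import Summits.RiemannHypothesis.RiemannHypothesis.Theorems.SemilocalNegCertUptoHundredThirtyNineKinkedF
import Summits.RiemannHypothesis.RiemannHypothesis.Theorems.SemilocalNegCertUptoHundredThirtyNineKinkedG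
import Summits.RiemannHypothesis.RiemannHypothesis.Theorems.SemilocalNegCertUptoHundredThirtyNineKinkedH
import Summits.RiemannHypothesis.RiemannHypothesis.Theorems.SemilocalNegCertUptoHundredThirtyNineKinkedI
import HarnessLib

/-!
# Semi-local threshold of the `{∞} ∪ {p < 149}` form, negative side: `a*({2,…,139}) ≤ 321/128` — the wall `q = 149` from a KINKED (piecewise-cubic) witness (part 12/18: the composition of the piece facts 0 … 149)

Cell `rh-explicit` (HOME `run/shared/lean/pub/rh-explicit/`), seat cc-s2-4 (A4 SEMILOCAL-TABLE, kernel column; pipeline gen11 `mkkinked.py`).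
Honest framing: theorems about the tree's `weilSemilocalThreshold S`; nothing here bears on RH.  No data is trusted: every bound is a
`decide +kernel` fact of the piecewise certificate `SemilocalPiecewiseCert.lean` (cc-s2-4 gen8).

Instance: `S = {p < 149}`, window `b = 321/128` (last /1024 value below `(log 151)/2`), `N = 150`, 47 atoms; odd piecewise-cubic
witness with 24 slope breaks at the atom images `|b − log n|` nearest `0` (atoms `n = 13, 11, 16, 9, 17, 8, 19, 7, 23, 25, 27, 29, 5, 31, 32, 37, 4, 41, 43, 47, 49, 3, 53, 59`,
rounded to `/1024`); float finder `Re Q/‖G‖² = -1.416e-04` (no polar credit); orders `(10, 4, 8, 4, 10, 40)`, 605 `t`-pieces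
(far widths ≤ 1/4); exact kernel margin `(rhs − lhs)/‖G‖² = 1.4144e-04`.  ⇒ **`a*({p < 149}) ≤ 321/128 < (log 151)/2`**.
The instance is split for the gate into part 1
(table, certificate, `checkMainPW`, the atom side in kernel chunks of ≤ 4 atoms via `SemilocalPiecewiseCertSplit.lean`), parts 2–10
(68 piece facts each in the FLEX layout of `SemilocalPiecewiseCertFlex.lean` (cc-s2-4 gen12, CC4-LEAN §17.2): piece `0` by `checkPiecePW`,
every far piece by `checkPieceFlex i ⟨n, m, K, m', u₀⟩` with the orders that piece needs (mean majorant degree ≈ 62 instead of 176) and a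
short dyadic centre `u₀ ≤ u_K(T₀)` — same witness, same cuts, claims recomputed (`⌈exact⌉ + 1`), kernel margin `1.4142e-04`·‖G‖²; each
fact file imports part 1 only), the Pieces part (composition) and the Final part (theorems).  Folklore throughout.
-/

set_option autoImplicit false
set_option linter.dupNamespace false  -- the mandated namespace repeats `RiemannHypothesis`
set_option Elab.async false  -- serialise the kernel facts: in parallel they exhaust the node's per-process heap (cc-s2-4 gen11, CC4-LEAN §16.10)

noncomputable section

open Complex Filter Set MeasureTheory Topology
open scoped Real

namespace Summit.RiemannHypothesis.RiemannHypothesis.Theorems.SemilocalPolyWitness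

open MeasureTheory Set Finset Real
open Literature.NumberTheory.LFunctions
open Summit.RiemannHypothesis.RiemannHypothesis.Theorems.MotivicDoor
open Summit.RiemannHypothesis.RiemannHypothesis.Theorems.MotivicDoor.SemilocalThreshold
open Summit.RiemannHypothesis.RiemannHypothesis.Theorems.MotivicDoor.SemilocalMarkov
open LQ

/-- pieces `0 ≤ i < 150` of `certUptoHundredThirtyNineKinked` check (FLEX form). -/
theorem check_UptoHundredThirtyNineKinked_pieces_1 : ∀ i, 0 ≤ i → i < 150 →
    certUptoHundredThirtyNineKinked.checkPiecePW i = true ∨ ∃ o, certUptoHundredThirtyNineKinked.checkPieceFlex i o = true := by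
  intro i hlo hhi
  interval_cases i
  · exact Or.inl check_UptoHundredThirtyNineKinked_piece0
  · exact Or.inr ⟨_, check_UptoHundredThirtyNineKinked_piece1⟩
  · exact Or.inr ⟨_, check_UptoHundredThirtyNineKinked_piece2⟩
  · exact Or.inr ⟨_, check_UptoHundredThirtyNineKinked_piece3⟩
  · exact Or.inr ⟨_, check_UptoHundredThirtyNineKinked_piece4⟩
  · exact Or.inr ⟨_, check_UptoHundredThirtyNineKinked_piece5⟩
  · exact Or.inr ⟨_, check_UptoHundredThirtyNineKinked_piece6⟩
  · exact Or.inr ⟨_, check_UptoHundredThirtyNineKinked_piece7⟩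
  · exact Or.inr ⟨_, check_UptoHundredThirtyNineKinked_piece8⟩
  · exact Or.inr ⟨_, check_UptoHundredThirtyNineKinked_piece9⟩
  · exact Or.inr ⟨_, check_UptoHundredThirtyNineKinked_piece10⟩
  · exact Or.inr ⟨_, check_UptoHundredThirtyNineKinked_piece11⟩
  · exact Or.inr ⟨_, check_UptoHundredThirtyNineKinked_piece12⟩
  · exact Or.inr ⟨_, check_UptoHundredThirtyNineKinked_piece13⟩
  · exact Or.inr ⟨_, check_UptoHundredThirtyNineKinked_piece14⟩
  · exact Or.inr ⟨_, check_UptoHundredThirtyNineKinked_piece15⟩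
  · exact Or.inr ⟨_, check_UptoHundredThirtyNineKinked_piece16⟩
  · exact Or.inr ⟨_, check_UptoHundredThirtyNineKinked_piece17⟩
  · exact Or.inr ⟨_, check_UptoHundredThirtyNineKinked_piece18⟩
  · exact Or.inr ⟨_, check_UptoHundredThirtyNineKinked_piece19⟩
  · exact Or.inr ⟨_, check_UptoHundredThirtyNineKinked_piece20⟩
  · exact Or.inr ⟨_, check_UptoHundredThirtyNineKinked_piece21⟩
  · exact Or.inr ⟨_, check_UptoHundredThirtyNineKinked_piece22⟩
  · exact Or.inr ⟨_, check_UptoHundredThirtyNineKinked_piece23⟩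
  · exact Or.inr ⟨_, check_UptoHundredThirtyNineKinked_piece24⟩
  · exact Or.inr ⟨_, check_UptoHundredThirtyNineKinked_piece25⟩
  · exact Or.inr ⟨_, check_UptoHundredThirtyNineKinked_piece26⟩
  · exact Or.inr ⟨_, check_UptoHundredThirtyNineKinked_piece27⟩
  · exact Or.inr ⟨_, check_UptoHundredThirtyNineKinked_piece28⟩
  · exact Or.inr ⟨_, check_UptoHundredThirtyNineKinked_piece29⟩
  · exact Or.inr ⟨_, check_UptoHundredThirtyNineKinked_piece30⟩
  · exact Or.inr ⟨_, check_UptoHundredThirtyNineKinked_piece31⟩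
  · exact Or.inr ⟨_, check_UptoHundredThirtyNineKinked_piece32⟩
  · exact Or.inr ⟨_, check_UptoHundredThirtyNineKinked_piece33⟩
  · exact Or.inr ⟨_, check_UptoHundredThirtyNineKinked_piece34⟩
  · exact Or.inr ⟨_, check_UptoHundredThirtyNineKinked_piece35⟩
  · exact Or.inr ⟨_, check_UptoHundredThirtyNineKinked_piece36⟩
  · exact Or.inr ⟨_, check_UptoHundredThirtyNineKinked_piece37⟩
  · exact Or.inr ⟨_, check_UptoHundredThirtyNineKinked_piece38⟩
  · exact Or.inr ⟨_, check_UptoHundredThirtyNineKinked_piece39⟩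
  · exact Or.inr ⟨_, check_UptoHundredThirtyNineKinked_piece40⟩
  · exact Or.inr ⟨_, check_UptoHundredThirtyNineKinked_piece41⟩
  · exact Or.inr ⟨_, check_UptoHundredThirtyNineKinked_piece42⟩
  · exact Or.inr ⟨_, check_UptoHundredThirtyNineKinked_piece43⟩
  · exact Or.inr ⟨_, check_UptoHundredThirtyNineKinked_piece44⟩
  · exact Or.inr ⟨_, check_UptoHundredThirtyNineKinked_piece45⟩
  · exact Or.inr ⟨_, check_UptoHundredThirtyNineKinked_piece46⟩
  · exact Or.inr ⟨_, check_UptoHundredThirtyNineKinked_piece47⟩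
  · exact Or.inr ⟨_, check_UptoHundredThirtyNineKinked_piece48⟩
  · exact Or.inr ⟨_, check_UptoHundredThirtyNineKinked_piece49⟩
  · exact Or.inr ⟨_, check_UptoHundredThirtyNineKinked_piece50⟩
  · exact Or.inr ⟨_, check_UptoHundredThirtyNineKinked_piece51⟩
  · exact Or.inr ⟨_, check_UptoHundredThirtyNineKinked_piece52⟩
  · exact Or.inr ⟨_, check_UptoHundredThirtyNineKinked_piece53⟩
  · exact Or.inr ⟨_, check_UptoHundredThirtyNineKinked_piece54⟩
  · exact Or.inr ⟨_, check_UptoHundredThirtyNineKinked_piece55⟩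
  · exact Or.inr ⟨_, check_UptoHundredThirtyNineKinked_piece56⟩
  · exact Or.inr ⟨_, check_UptoHundredThirtyNineKinked_piece57⟩
  · exact Or.inr ⟨_, check_UptoHundredThirtyNineKinked_piece58⟩
  · exact Or.inr ⟨_, check_UptoHundredThirtyNineKinked_piece59⟩
  · exact Or.inr ⟨_, check_UptoHundredThirtyNineKinked_piece60⟩
  · exact Or.inr ⟨_, check_UptoHundredThirtyNineKinked_piece61⟩
  · exact Or.inr ⟨_, check_UptoHundredThirtyNineKinked_piece62⟩
  · exact Or.inr ⟨_, check_UptoHundredThirtyNineKinked_piece63⟩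
  · exact Or.inr ⟨_, check_UptoHundredThirtyNineKinked_piece64⟩
  · exact Or.inr ⟨_, check_UptoHundredThirtyNineKinked_piece65⟩
  · exact Or.inr ⟨_, check_UptoHundredThirtyNineKinked_piece66⟩
  · exact Or.inr ⟨_, check_UptoHundredThirtyNineKinked_piece67⟩
  · exact Or.inr ⟨_, check_UptoHundredThirtyNineKinked_piece68⟩
  · exact Or.inr ⟨_, check_UptoHundredThirtyNineKinked_piece69⟩
  · exact Or.inr ⟨_, check_UptoHundredThirtyNineKinked_piece70⟩
  · exact Or.inr ⟨_, check_UptoHundredThirtyNineKinked_piece71⟩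
  · exact Or.inr ⟨_, check_UptoHundredThirtyNineKinked_piece72⟩
  · exact Or.inr ⟨_, check_UptoHundredThirtyNineKinked_piece73⟩
  · exact Or.inr ⟨_, check_UptoHundredThirtyNineKinked_piece74⟩
  · exact Or.inr ⟨_, check_UptoHundredThirtyNineKinked_piece75⟩
  · exact Or.inr ⟨_, check_UptoHundredThirtyNineKinked_piece76⟩
  · exact Or.inr ⟨_, check_UptoHundredThirtyNineKinked_piece77⟩
  · exact Or.inr ⟨_, check_UptoHundredThirtyNineKinked_piece78⟩
  · exact Or.inr ⟨_, check_UptoHundredThirtyNineKinked_piece79⟩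
  · exact Or.inr ⟨_, check_UptoHundredThirtyNineKinked_piece80⟩
  · exact Or.inr ⟨_, check_UptoHundredThirtyNineKinked_piece81⟩
  · exact Or.inr ⟨_, check_UptoHundredThirtyNineKinked_piece82⟩
  · exact Or.inr ⟨_, check_UptoHundredThirtyNineKinked_piece83⟩
  · exact Or.inr ⟨_, check_UptoHundredThirtyNineKinked_piece84⟩
  · exact Or.inr ⟨_, check_UptoHundredThirtyNineKinked_piece85⟩
  · exact Or.inr ⟨_, check_UptoHundredThirtyNineKinked_piece86⟩
  · exact Or.inr ⟨_, check_UptoHundredThirtyNineKinked_piece87⟩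
  · exact Or.inr ⟨_, check_UptoHundredThirtyNineKinked_piece88⟩
  · exact Or.inr ⟨_, check_UptoHundredThirtyNineKinked_piece89⟩
  · exact Or.inr ⟨_, check_UptoHundredThirtyNineKinked_piece90⟩
  · exact Or.inr ⟨_, check_UptoHundredThirtyNineKinked_piece91⟩
  · exact Or.inr ⟨_, check_UptoHundredThirtyNineKinked_piece92⟩
  · exact Or.inr ⟨_, check_UptoHundredThirtyNineKinked_piece93⟩
  · exact Or.inr ⟨_, check_UptoHundredThirtyNineKinked_piece94⟩
  · exact Or.inr ⟨_, check_UptoHundredThirtyNineKinked_piece95⟩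
  · exact Or.inr ⟨_, check_UptoHundredThirtyNineKinked_piece96⟩
  · exact Or.inr ⟨_, check_UptoHundredThirtyNineKinked_piece97⟩
  · exact Or.inr ⟨_, check_UptoHundredThirtyNineKinked_piece98⟩
  · exact Or.inr ⟨_, check_UptoHundredThirtyNineKinked_piece99⟩
  · exact Or.inr ⟨_, check_UptoHundredThirtyNineKinked_piece100⟩
  · exact Or.inr ⟨_, check_UptoHundredThirtyNineKinked_piece101⟩
  · exact Or.inr ⟨_, check_UptoHundredThirtyNineKinked_piece102⟩
  · exact Or.inr ⟨_, check_UptoHundredThirtyNineKinked_piece103⟩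
  · exact Or.inr ⟨_, check_UptoHundredThirtyNineKinked_piece104⟩
  · exact Or.inr ⟨_, check_UptoHundredThirtyNineKinked_piece105⟩
  · exact Or.inr ⟨_, check_UptoHundredThirtyNineKinked_piece106⟩
  · exact Or.inr ⟨_, check_UptoHundredThirtyNineKinked_piece107⟩
  · exact Or.inr ⟨_, check_UptoHundredThirtyNineKinked_piece108⟩
  · exact Or.inr ⟨_, check_UptoHundredThirtyNineKinked_piece109⟩
  · exact Or.inr ⟨_, check_UptoHundredThirtyNineKinked_piece110⟩
  · exact Or.inr ⟨_, check_UptoHundredThirtyNineKinked_piece111⟩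
  · exact Or.inr ⟨_, check_UptoHundredThirtyNineKinked_piece112⟩
  · exact Or.inr ⟨_, check_UptoHundredThirtyNineKinked_piece113⟩
  · exact Or.inr ⟨_, check_UptoHundredThirtyNineKinked_piece114⟩
  · exact Or.inr ⟨_, check_UptoHundredThirtyNineKinked_piece115⟩
  · exact Or.inr ⟨_, check_UptoHundredThirtyNineKinked_piece116⟩
  · exact Or.inr ⟨_, check_UptoHundredThirtyNineKinked_piece117⟩
  · exact Or.inr ⟨_, check_UptoHundredThirtyNineKinked_piece118⟩
  · exact Or.inr ⟨_, check_UptoHundredThirtyNineKinked_piece119⟩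
  · exact Or.inr ⟨_, check_UptoHundredThirtyNineKinked_piece120⟩
  · exact Or.inr ⟨_, check_UptoHundredThirtyNineKinked_piece121⟩
  · exact Or.inr ⟨_, check_UptoHundredThirtyNineKinked_piece122⟩
  · exact Or.inr ⟨_, check_UptoHundredThirtyNineKinked_piece123⟩
  · exact Or.inr ⟨_, check_UptoHundredThirtyNineKinked_piece124⟩
  · exact Or.inr ⟨_, check_UptoHundredThirtyNineKinked_piece125⟩
  · exact Or.inr ⟨_, check_UptoHundredThirtyNineKinked_piece126⟩
  · exact Or.inr ⟨_, check_UptoHundredThirtyNineKinked_piece127⟩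
  · exact Or.inr ⟨_, check_UptoHundredThirtyNineKinked_piece128⟩
  · exact Or.inr ⟨_, check_UptoHundredThirtyNineKinked_piece129⟩
  · exact Or.inr ⟨_, check_UptoHundredThirtyNineKinked_piece130⟩
  · exact Or.inr ⟨_, check_UptoHundredThirtyNineKinked_piece131⟩
  · exact Or.inr ⟨_, check_UptoHundredThirtyNineKinked_piece132⟩
  · exact Or.inr ⟨_, check_UptoHundredThirtyNineKinked_piece133⟩
  · exact Or.inr ⟨_, check_UptoHundredThirtyNineKinked_piece134⟩
  · exact Or.inr ⟨_, check_UptoHundredThirtyNineKinked_piece135⟩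
  · exact Or.inr ⟨_, check_UptoHundredThirtyNineKinked_piece136⟩
  · exact Or.inr ⟨_, check_UptoHundredThirtyNineKinked_piece137⟩
  · exact Or.inr ⟨_, check_UptoHundredThirtyNineKinked_piece138⟩
  · exact Or.inr ⟨_, check_UptoHundredThirtyNineKinked_piece139⟩
  · exact Or.inr ⟨_, check_UptoHundredThirtyNineKinked_piece140⟩
  · exact Or.inr ⟨_, check_UptoHundredThirtyNineKinked_piece141⟩
  · exact Or.inr ⟨_, check_UptoHundredThirtyNineKinked_piece142⟩
  · exact Or.inr ⟨_, check_UptoHundredThirtyNineKinked_piece143⟩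
  · exact Or.inr ⟨_, check_UptoHundredThirtyNineKinked_piece144⟩
  · exact Or.inr ⟨_, check_UptoHundredThirtyNineKinked_piece145⟩
  · exact Or.inr ⟨_, check_UptoHundredThirtyNineKinked_piece146⟩
  · exact Or.inr ⟨_, check_UptoHundredThirtyNineKinked_piece147⟩
  · exact Or.inr ⟨_, check_UptoHundredThirtyNineKinked_piece148⟩
  · exact Or.inr ⟨_, check_UptoHundredThirtyNineKinked_piece149⟩

end Summit.RiemannHypothesis.RiemannHypothesis.Theorems.SemilocalPolyWitness

end
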